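import Literature.Computability.Complexity.PolynomialEntropyApproximation
import Literature.Computability.Complexity.RandomizingPolynomialsPerfect
import Literature.Computability.MetaComplexity.HeuristicClasses
import Literature.Computability.MetaComplexity.SamplableMixtures
import HarnessLib

/-!
# Route SzkEntropy, crux `PeaWorstToAvg` (stmt-PneNP-10777): objects of the line `dual-mode-compile` (definitions)

Objects posited by the line `dual-mode-compile` for the crux `SzkEntropy.PeaWorstToAvg`
(skeleton `Summits/PneNP/PneNP/Cruxes/PeaWorstToAvg/Lines/dual-mode-compile.lean`, whose registered stubs
`stub_modeEncoding`, `stub_compile`, `stub_canon`, `stub_adviceElim`, `stub_decider` are stated in exactly this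
vocabulary and namespace):

* `AffLabel`, `AffBP`, `AffBPMap` — affine parity branching programs (sparse presentation: node `i` lists the affine
  labels of its forward edges), their Ishai–Kushilevitz matrix `AffBP.mat` (labels on and above the diagonal, `1` on
  the subdiagonal, `0` below) and value `AffBP.eval = det`, output entropy `AffBPMap.entropy`, Boolean encodings;
* `BPEAInst`, `BPEA` — Branching-Program Entropy Approximation with gap `1` at integer thresholds (the convention of
  the tree's `PEA`): YES `H(F(U_ℓ)) ≥ k + 1`, NO `H(F(U_ℓ)) ≤ k`;
* `UHeurBPP` — randomized heuristic schemes (Bogdanov–Trevisan Def. 2.12–2.13, the tree's `HeurBPP`) whose coin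
  budget is an honest polynomial of the input length (the UNIFORM sub-class; the tree's `RandAlg.coinLen` is an
  arbitrary polynomially bounded function, i.e. `O(log)` advice — `SzkEntropyPeaWorstToAvgAdviceLeak.lean`);
* `ModeKit` (+ `ModeKit.law`, `ModeKit.mix`) — a certified dual-mode pair of uniform branching-program samplers plus a
  mode-preserving `1/16`-statistical randomized encoder of `PEA 3` onto it (the object asserted by the closing stub);
* `entryOf`, `blockOf` — the symbolic Ishai–Kushilevitz product `R₁ · L · R₂` (entries on and above the diagonal) for an
  ARBITRARY symbolic unit-lower-Hessenberg matrix `Lsym` (the tree's `RandPoly.entry/ikBlock` are the path-matrix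
  case `Lsym = symL T ρ d`): the degree-3 block of one branching program, vocabulary of `stub_blockPerf`/`stub_compile`;
* sanity: `BPEA_disjoint`, `encode_bpeaEmpty_mem_no`, `encode_bpeaEdge_mem_yes` (both promise sides inhabited at a
  fixed instance — the BavardGap lesson), `UHeurBPP_subset_HeurBPP`.

Definitions only (no facts are asserted beyond the four sanity lemmas); the stubs and the composition live in the
skeleton and land as `SzkEntropyPeaWorstToAvgDualModeCompile*.lean`.  Sources: Ishai–Kushilevitz, ICALP 2002, §3
(the matrix `L(x)`, randomizing polynomials of branching programs); Applebaum–Ishai–Kushilevitz, SICOMP 36 (2006), §4;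
Dvir–Gutfreund–Rothblum–Vadhan, ICS 2011, Def. 2.1, Thm. 4.5–4.6; Goldreich–Sahai–Vadhan, CRYPTO 1999 (Entropy
Approximation); Bogdanov–Trevisan, FnT–TCS 2 (2006), Def. 2.1, 2.12–2.13; Applebaum–Raykov, CRYPTO 2016 (statistical
randomized encodings); Peikert–Waters, STOC 2008 (dual-mode families).
-/

noncomputable section

open _root_.Computability
open Literature.InformationTheory.Entropy (mapEntropy)
open Literature.Computability.Complexity Literature.Computability.MetaComplexity

namespace Summit.PneNP.PneNP.Cruxes.PeaWorstToAvg.DualModeCompile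

set_option linter.dupNamespace false -- `Summit.PneNP.PneNP.…`: summit = sub-problem name (D-0017 single-conjunct layout)

/-! ### Affine parity branching programs -/

/-- An AFFINE LABEL over `ℓ` input bits: a constant bit and a list of variable indices; its value at `x ∈ F₂^ℓ` is
`c + Σ_{i ∈ S} xᵢ` (repetitions cancel in pairs).  Ordinary branching-program labels `1`, `xᵢ`, `¬xᵢ = 1 + xᵢ` are the
cases `|S| ≤ 1`. [cite: IshaiKushilevitz2002, §3] -/
abbrev AffLabel (ℓ : ℕ) : Type := Bool × List (Fin ℓ)

namespace AffLabel

/-- Value of an affine label at an input: `c + Σ_{i ∈ S} xᵢ`. [cite: IshaiKushilevitz2002, §3] -/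
def eval {ℓ : ℕ} (a : AffLabel ℓ) (x : Fin ℓ → ZMod 2) : ZMod 2 :=
  (if a.1 then 1 else 0) + (a.2.map x).sum

end AffLabel

/-- An AFFINE PARITY BRANCHING PROGRAM on `ℓ` input bits (sparse presentation): nodes `0, …, N` with `N = P.length`,
source `0`, sink `N`; row `i` lists the labels of the edges `i → i+1, i → i+2, …` (missing entries: label `0`, i.e.
no edge).  Its value is the number modulo `2` of source-to-sink paths weighted by the product of the edge labels —
every `⊕L` / deterministic-logspace keyed function has polynomial-size such programs (one per output bit).
[cite: IshaiKushilevitz2002, §3] [cite: ApplebaumIshaiKushilevitz2006, §4] -/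
abbrev AffBP (ℓ : ℕ) : Type := List (List (AffLabel ℓ))

namespace AffBP

variable {ℓ : ℕ}

/-- The label of the edge from node `i` to node `j + 1` (meaningful for `i ≤ j`; default `0` = no edge). [cite: IshaiKushilevitz2002, §3] -/
def label (P : AffBP ℓ) (i j : ℕ) : AffLabel ℓ :=
  (P.getD i []).getD (j - i) (false, [])

/-- **The Ishai–Kushilevitz matrix** `L(x)` of the program at input `x`: rows = nodes `0 … N-1`, columns = nodes
`1 … N`; entry `(i, j)` = value of the label of the edge `i → j+1` for `i ≤ j`, `1` on the subdiagonal (`i = j + 1`;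
`-1 = 1` over `F₂`), `0` below it (a unit-lower-Hessenberg matrix). [cite: IshaiKushilevitz2002, §3] -/
def mat (P : AffBP ℓ) (x : Fin ℓ → ZMod 2) : Matrix (Fin P.length) (Fin P.length) (ZMod 2) :=
  Matrix.of fun i j =>
    if i.val ≤ j.val then (P.label i.val j.val).eval x else if i.val = j.val + 1 then 1 else 0

/-- **Value of the program** at `x`: `det L(x)` = the weighted number of source-to-sink paths mod `2` (expansion of
the unit-lower-Hessenberg determinant; for `N = 0` the empty determinant `1`). [cite: IshaiKushilevitz2002, §3] -/
def eval (P : AffBP ℓ) (x : Fin ℓ → ZMod 2) : ZMod 2 :=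
  (P.mat x).det

end AffBP

/-- A multi-output affine parity branching program on `ℓ` input bits: one program per output bit.
[cite: ApplebaumIshaiKushilevitz2006, §4] -/
abbrev AffBPMap (ℓ : ℕ) : Type := List (AffBP ℓ)

namespace AffBPMap

variable {ℓ : ℕ}

/-- The output word at `x`. [cite: ApplebaumIshaiKushilevitz2006, §4] -/
def eval (F : AffBPMap ℓ) (x : Fin ℓ → ZMod 2) : List (ZMod 2) :=
  F.map fun P => P.eval x

/-- **Output entropy** `H(F(U_ℓ))` in bits of the map on a uniform input (`mapEntropy`, as for `PolyMapF2.entropy`).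
[cite: DvirGutfreundRothblumVadhan2010, Def. 2.1] -/
def entropy (F : AffBPMap ℓ) : ℝ :=
  mapEntropy Finset.univ F.eval

/-- Boolean encoding of multi-output affine programs on `ℓ` inputs (labels: bit paired with a list of variable
indices in binary; nested self-delimiting lists — the combinators of `PEAInst.encoding`). [folklore] -/
def encoding (ℓ : ℕ) : Encoding (AffBPMap ℓ) Bool :=
  ((encodingBoolBool.pairBool (encodingFinBool ℓ).listBool).listBool.listBool).listBool

end AffBPMap

/-! ### `BPEA`: entropy approximation for branching-program samplers -/

/-- Instances of `BPEA`: number of input bits `ℓ`, a multi-output affine parity branching program on `ℓ` bits, an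
integer entropy threshold `k`. [cite: DvirGutfreundRothblumVadhan2010, Thm. 4.5–4.6] -/
abbrev BPEAInst : Type := Σ ℓ : ℕ, AffBPMap ℓ × ℕ

/-- Boolean encoding of `BPEA` instances: `ℓ` in binary, then the program paired with `k` in binary. [folklore] -/
def BPEAInst.encoding : Encoding BPEAInst Bool :=
  Encoding.sigmaBool fun ℓ => (AffBPMap.encoding ℓ).pairBool encodingNatBool

/-- **`BPEA` — Branching-Program Entropy Approximation** (gap `1` at integer thresholds, the convention of `PEA`): on
`(F, k)` with `F` a multi-output affine parity branching program, YES iff `H(F(U_ℓ)) ≥ k + 1`, NO iff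
`H(F(U_ℓ)) ≤ k`.  Entropy Approximation [Goldreich–Sahai–Vadhan 1999] for `⊕`-branching-program samplers — the format
in which every logspace keyed family presents its two modes, and the source of the AIK compile `BPEA ≤ₚ PEA 3`
(`stub_compile`). [cite: DvirGutfreundRothblumVadhan2010, Thm. 4.5–4.6] [cite: GoldreichSahaiVadhan1999, Def. of EA] -/
def BPEA : PromiseProblem :=
  PromiseProblem.ofEncoding BPEAInst.encoding
    {I | (I.2.2 : ℝ) + 1 ≤ AffBPMap.entropy I.2.1}
    {I | AffBPMap.entropy I.2.1 ≤ (I.2.2 : ℝ)}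

/-! ### Uniform heuristic schemes -/

/-- `UHeurBPP`: randomized heuristic schemes `A(x, 1ⁿ, 1ᵐ)` (Bogdanov–Trevisan Def. 2.12–2.13, the tree's `HeurBPP`:
for every `n` and `m > 0` the inputs on which `A` errs with probability `≥ 1/4` have `Dₙ`-mass `≤ 1/m`) whose coin
budget is an honest POLYNOMIAL of the input length — the uniform sub-class of the tree's `HeurBPP` (whose
`RandAlg.coinLen` is only polynomially bounded, i.e. `O(log)` advice). [cite: BogdanovTrevisan2006, Def. 2.12–2.13] -/
def UHeurBPP : Set DistProblem :=
  {Q | ∃ A : RandAlg (List Bool × ℕ × ℕ) Bool, A.IsPolyTime schemeEnc encodeBool ∧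
    (∃ c : Polynomial ℕ, ∀ ℓ, A.coinLen ℓ = c.eval ℓ) ∧
    ∀ n m : ℕ, 0 < m →
      Q.dist.prob n {x | 1 / 4 ≤ A.pr schemeEnc (x, n, m) {b | b ≠ Q.lang.boolIndicator x}} ≤ 1 / m}

/-! ### Mode kits -/

/-- **Mode kit** — a CERTIFIED DUAL-MODE PAIR of branching-program samplers plus a MODE-PRESERVING RANDOMIZED ENCODING
of `PEA 3` onto it:
* `samp b` (`b = false/true`): UNIFORM polynomial-time samplers (honest polynomial coin budget `sampCoins`) whose
  output on `1ⁿ` is, for EVERY coin outcome and every `n`, a NO (resp. YES) instance of `BPEA` — the "lossy" and the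
  "injective" mode, certified BY THE SAMPLER, never by inspecting the instance;
* `enc`: ONE uniform polynomial-time randomized map on strings (coin budget `encCoins`) such that for every YES
  instance `x` of `PEA 3` the law of `enc x` is `1/16`-close, on every event, to the law of `samp true` on `1^{|x|}`,
  and for every NO instance to that of `samp false` (one-sided event bounds over all events = total variation
  `≤ 1/16`).
So `enc` is a statistical randomized encoding of the promise problem `PEA 3` whose two simulators are the certified
mode samplers; it need not preserve entropy and need not land on the promise for every coin.
[cite: ApplebaumRaykov2016, Def. 1 and Thm. 3] [cite: PeikertWaters2008, §1 (dual-mode / lossy families)] -/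
structure ModeKit where
  /-- certified sampler of mode `b` on input `1ⁿ` -/
  samp : Bool → RandAlg ℕ (List Bool)
  /-- the samplers are probabilistic polynomial time -/
  samp_polyTime : ∀ b, (samp b).IsPolyTime unaryEncodeNat (id : List Bool → List Bool)
  /-- their coin budget is this polynomial of the input length (uniformity) -/
  sampCoins : Polynomial ℕ
  /-- the coin budget is honest -/
  samp_coinLen : ∀ b ℓ, (samp b).coinLen ℓ = sampCoins.eval ℓ
  /-- mode `false` is certified NO -/
  samp_no : ∀ n, ∀ w ∈ ((samp false).outputPMF unaryEncodeNat n).support, w ∈ BPEA.no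
  /-- mode `true` is certified YES -/
  samp_yes : ∀ n, ∀ w ∈ ((samp true).outputPMF unaryEncodeNat n).support, w ∈ BPEA.yes
  /-- the mode-preserving randomized encoder on instance strings -/
  enc : RandAlg (List Bool) (List Bool)
  /-- the encoder is probabilistic polynomial time -/
  enc_polyTime : enc.IsPolyTime (id : List Bool → List Bool) (id : List Bool → List Bool)
  /-- its coin budget, a polynomial -/
  encCoins : Polynomial ℕ
  /-- the coin budget is honest -/
  enc_coinLen : ∀ ℓ, enc.coinLen ℓ = encCoins.eval ℓ
  /-- YES instances are encoded `1/16`-close to the YES mode -/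
  enc_yes : ∀ x ∈ (PEA 3).yes, ∀ E : Set (List Bool),
    enc.pr id x E ≤ (samp true).pr unaryEncodeNat x.length E + 1 / 16
  /-- NO instances are encoded `1/16`-close to the NO mode -/
  enc_no : ∀ x ∈ (PEA 3).no, ∀ E : Set (List Bool),
    enc.pr id x E ≤ (samp false).pr unaryEncodeNat x.length E + 1 / 16

namespace ModeKit

/-- The certified law of mode `b`: `n ↦` law of `samp b` on `1ⁿ`. [cite: BogdanovTrevisan2006, Def. 2.1] -/
def law (kit : ModeKit) (b : Bool) : Ensemble := fun n => (kit.samp b).outputPMF unaryEncodeNat n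

/-- The hard ensemble of the line: the fair mixture of the two certified laws (`mixEnsemble`).
[cite: BogdanovTrevisan2006, Def. 2.1] -/
def mix (kit : ModeKit) : Ensemble := mixEnsemble (kit.law false) (kit.law true)

end ModeKit

/-! ### The symbolic Ishai–Kushilevitz block of a general Hessenberg matrix -/

/-- Entry `(i, k)` of the symbolic product `R₁ · L · R₂` for a SYMBOLIC `(d+1) × (d+1)` matrix `Lsym` (entry `(j, l)` a
sparse polynomial `Lsym j l`), with the tree's symbolic randomizers `RandPoly.symR1` (upper unitriangular, fresh
variables `n₀ + pos i j`, `i < j`) and `RandPoly.symR2` (last column, fresh variables `n₀ + pos l l`, `l < d`):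
`Σ_{j,l} R₁[i,j] · Lsym[j,l] · R₂[l,k]`.  For `Lsym = RandPoly.symL T ρ d` this is `RandPoly.entry n₀ T ρ d i k`.
[cite: IshaiKushilevitz2002, §3] -/
def entryOf (n₀ d : ℕ) (Lsym : ℕ → ℕ → List (List ℕ)) (i k : ℕ) : List (List ℕ) :=
  (List.range (d + 1)).flatMap fun j => (List.range (d + 1)).flatMap fun l =>
    RandPoly.mulP (RandPoly.mulP (RandPoly.symR1 n₀ i j) (Lsym j l)) (RandPoly.symR2 n₀ d l k)

/-- **The degree-3 block** of a symbolic Hessenberg matrix: the entries `(i, k)`, `i ≤ k ≤ d`, of `R₁ · Lsym · R₂`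
(row by row, `RandPoly.pairsLE d`), fresh variables numbered from `n₀` (`RandPoly.pos d d` of them).  For
`Lsym = RandPoly.symL T ρ (|T| - 1)` this is `RandPoly.ikBlock n₀ T ρ`. [cite: IshaiKushilevitz2002, §3]
[cite: ApplebaumIshaiKushilevitz2006, §4.2] -/
def blockOf (n₀ d : ℕ) (Lsym : ℕ → ℕ → List (List ℕ)) : List (List (List ℕ)) :=
  (RandPoly.pairsLE d).map fun ik => entryOf n₀ d Lsym ik.1 ik.2

/-! ### Sanity -/

/-- `BPEA` is a disjoint promise problem (`k + 1 ≤ H` and `H ≤ k` are incompatible; encodings are injective). [folklore] -/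
theorem BPEA_disjoint : BPEA.Disjoint := by
  refine PromiseProblem.disjoint_ofEncoding _ (Set.disjoint_left.2 fun I hY hN => ?_)
  simp only [Set.mem_setOf_eq] at hY hN
  linarith

/-- Uniform schemes are schemes: `UHeurBPP ⊆ HeurBPP`. [cite: BogdanovTrevisan2006, Def. 2.12–2.13] -/
theorem UHeurBPP_subset_HeurBPP : UHeurBPP ⊆ HeurBPP := by
  rintro Q ⟨A, hA, -, hbad⟩
  exact ⟨A, hA, hbad⟩

/-- The empty program list on `0` inputs with threshold `0` is a NO instance of `BPEA` (`H = 0 ≤ 0`): the NO side is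
inhabited at a fixed instance. [folklore] -/
theorem encode_bpeaEmpty_mem_no : BPEAInst.encoding.encode ⟨0, ([], 0)⟩ ∈ BPEA.no := by
  refine (BPEAInst.encoding.mem_toLanguage_iff _ _).2 ?_
  show AffBPMap.entropy ([] : AffBPMap 0) ≤ ((0 : ℕ) : ℝ)
  have h : AffBPMap.eval ([] : AffBPMap 0) = fun _ => [] := by
    funext x
    simp [AffBPMap.eval]
  rw [AffBPMap.entropy, h, Literature.InformationTheory.Entropy.mapEntropy_const]
  simp

/-- The one-edge program `x₀` on `1` input with threshold `0` is a YES instance of `BPEA` (`H = 1 ≥ 0 + 1`): the YES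
side is inhabited too. [folklore] -/
theorem encode_bpeaEdge_mem_yes :
    BPEAInst.encoding.encode ⟨1, ([[[((false, [0]) : AffLabel 1)]]], 0)⟩ ∈ BPEA.yes := by
  refine (BPEAInst.encoding.mem_toLanguage_iff _ _).2 ?_
  show ((0 : ℕ) : ℝ) + 1 ≤ AffBPMap.entropy ([[[((false, [0]) : AffLabel 1)]]] : AffBPMap 1)
  have hev : AffBPMap.eval ([[[((false, [0]) : AffLabel 1)]]] : AffBPMap 1) = fun x => [x 0] := by
    funext x
    simp [AffBPMap.eval, AffBP.eval, AffBP.mat, AffBP.label, AffLabel.eval, Matrix.det_unique]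
  have hinj : Function.Injective (AffBPMap.eval ([[[((false, [0]) : AffLabel 1)]]] : AffBPMap 1)) := by
    rw [hev]
    intro x y hxy
    funext i
    fin_cases i
    simpa using hxy
  have hH := Literature.InformationTheory.Entropy.mapEntropy_of_injective
    (Finset.univ : Finset (Fin 1 → ZMod 2)) hinj
  rw [AffBPMap.entropy, hH]
  simp

end Summit.PneNP.PneNP.Cruxes.PeaWorstToAvg.DualModeCompile

end
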